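/-
Copyright (c) 2026 the pub-hodgecm-mathlib formalisation cell (harness21).  Prover seat hodgecm-mathlib-K2Liu-p06 (g3): Track B «K2-LIT»,
hLiu418 = stmt-HodgeConjecture-24832, director req649 (S1) ∕ LEAD F0P6-plan (g11) deal of record 2026-09-04T05:23:13Z = organ Φ2 of ROAD Φ
(ruling «M-155l» §2; CENSUS-41 row Φ2): file 4 «THE INDUCING CHARACTER DIES ON THE MIDDLE STABILISERS»; 2026-09-04.
-/
import Summits.HodgeConjecture.HodgeConjecture.Theorems.K2LiuSiegelEisensteinCoeffOrbitSum      -- ★ Φ2 files 1–3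
import Mathlib.LinearAlgebra.Matrix.Charpoly.Coeff
import HarnessLib

/-!
# Crux `HLiu418`, ROAD Φ, organ Φ2 (file 4): THE INDUCING CHARACTER IS TRIVIAL ON THE MIDDLE STABILISERS —
# `det_Δ(w_g n(X) w_g) = 1` under the corner condition `(1 − G) X (1 − G) = 0` (a unipotent determinant over the REDUCED ring `𝔸_L`)

Cell `hodgecm-mathlib`, crux item hLiu418 = `stmt-HodgeConjecture-24832`, route `HCCMUnconditional`; squad K2 ∕ K2Liu, LEAD F0P6-plan (g11 → g12), deal req649
(S1), prover K2Liu-p06 (g3).  THEOREMS ONLY (no `def`, no instance, no notation, no named-fact hypothesis, no `sorry`); lane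
`--supports stmt-HodgeConjecture-24832 --as helper` (count-neutral).

WHY.  ★ file 3 `tsum_section_eq_zero` kills the `N_Δ(L⁺)`-orbit of a middle coset `[γ₀]` as soon as an ADELIC stabiliser element `s₀ ∈ N_Δ(𝔸)` has
`γ₀ s₀ γ₀⁻¹ ∈ P_Δ(𝔸)` WITH TRIVIAL INDUCING CHARACTER `χ(det_Δ)|det_Δ|^{s+n/2}(γ₀ s₀ γ₀⁻¹) = 1` and `ψ_S(s₀) ≠ 1`.  For the reflection representatives
`γ₀ = w_g = ι(1, g)` of ★ B2b (`g² = 1`, `G = reindex e g`, idempotent `E = ⅟2(1 − G)`), ★ `isSiegelDelta_conj_unip_iff` gives the stabiliser: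
`w_g n(X) w_g ∈ P_Δ(𝔸) ⟺ (1 − G) X (1 − G) = 0`.  THIS FILE proves that on it the inducing character is trivial, because the `Δ`-block of
`w_g n(X) w_g` is `1 − 2XE` (frame calculus ★ B2a∕B2b) with `(2XE)² = 4·X(EXE)E = 0` — a UNIPOTENT matrix — and over a REDUCED commutative ring a unipotent
matrix has determinant `1` (Mathlib `Matrix.isUnit_charpolyRev_of_isNilpotent` + `Polynomial.isUnit_iff_coeff_isUnit_isNilpotent`); `𝔸_L` is reduced
(a product of fields and a restricted product of fields).

* §1 `isReduced_adeleRing` — `𝔸_K` is reduced (any number field `K`).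
* §2 **`det_one_add_eq_one_of_isNilpotent`** — `det(1 + N) = 1` for nilpotent `N` over a reduced commutative ring (via `charpolyRev`).
* §3 frame algebra: `toBlocks₁₁_reflFrame_mul_unip_mul_reflFrame` (`(W_E n(X) W_E)₁₁ = 1 − 2•(X E)`), nilpotency under the corner condition.
* §4 **`detDelta_reflection_conj_unip`**: `det_Δ(w_g u w_g) = 1` for `u ∈ N_Δ(𝔸)` with `(1 − G) X(u) (1 − G) = 0`;
  `siegelDeltaCharacter_eq_one_of_detDelta_eq_one`; **`siegelDeltaCharacter_reflection_conj_unip`** (`= 1`); and the bundle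
  **`reflection_stabilizer_data`**: `IsSiegelDelta (w_g u w_g⁻¹) ∧ siegelDeltaCharacter χ s (w_g u w_g⁻¹) = 1` — exactly the hypotheses `hs₀P`, `hs₀χ` of
  ★ file 3 `tsum_section_eq_zero` ∕ ★ file 2 `integral_wt_smul_conj_mul_apply_eq_zero` at `γ₀ = w_g`, `s₀ = u`.
WHAT REMAINS for «`det S ≠ 0 ⇒ MID_S = 0`»: (E1) Bruhat exhaustion of REST by the reflection orbits (organ B2c); (E3) for `det S ≠ 0`, an `X` in the corner
subspace with `ψ_L(tr(S X)) ≠ 1` (sequel file 5).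
[MoeglinWaldspurger1995, II.1.7], [KudlaRallis1994, §2], [GelbartPiatetskishapiroRallis1987, Part A §§1–2], [Tan1999, §3].

HONEST LABEL.  Count-neutral helper; `HC_CM` is proved only modulo the 7 printed citations (2 remaining named inputs: hLiu418 = `stmt-HodgeConjecture-24832`,
h413 = `stmt-HodgeConjecture-24833`) until rung 0 closes.
-/

set_option autoImplicit false
set_option linter.dupNamespace false -- the mandated namespace repeats `HodgeConjecture.HodgeConjecture`

noncomputable section

open scoped Matrix
open NumberField IsDedekindDomain Polynomial
open Literature.NumberTheory.Automorphic Literature.NumberTheory.GaloisRepresentations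
open Literature.NumberTheory.GelbartRogawski1991 Literature.NumberTheory.GelbartRogawski1991.GRConstruction
open Literature.NumberTheory.K2Lit.SiegelDoubled

namespace Summit.HodgeConjecture.HodgeConjecture.Cruxes.HLiu418.K2LiuSiegelMiddleStabilizerCharacter

open K2LiuSiegelBruhatMiddleCell K2LiuSiegelBruhatMiddleCellDelta K2LiuSiegelBigCellFree

/-! ## §1 The adele ring is reduced -/

/-- The finite adele ring (a restricted product of fields) is reduced. [folklore] -/
theorem isReduced_finiteAdeleRing (K : Type) [Field K] [NumberField K] : IsReduced (FiniteAdeleRing (𝓞 K) K) := by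
  refine ⟨fun x hx => ?_⟩
  obtain ⟨k, hk⟩ := hx
  refine RestrictedProduct.ext _ _ fun v => ?_
  have h : (x v) ^ k = 0 := congrArg (fun y : FiniteAdeleRing (𝓞 K) K => y v) hk
  exact IsNilpotent.eq_zero ⟨k, h⟩

/-- **`𝔸_K` is reduced** (`K_∞ × 𝔸_K^∞`: a finite product of fields times a restricted product of fields). [folklore] -/
theorem isReduced_adeleRing (K : Type) [Field K] [NumberField K] : IsReduced (AdeleRing (𝓞 K) K) := by
  haveI : IsReduced (InfiniteAdeleRing K) := inferInstanceAs (IsReduced ((v : InfinitePlace K) → v.Completion))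
  haveI := isReduced_finiteAdeleRing K
  exact inferInstanceAs (IsReduced (InfiniteAdeleRing K × FiniteAdeleRing (𝓞 K) K))

/-! ## §2 A unipotent matrix over a reduced ring has determinant one -/

section Reduced

variable {R : Type*} [CommRing R] {m : Type*} [Fintype m] [DecidableEq m]

/-- `det(1 − t N)` is the evaluation of Mathlib's reversed characteristic polynomial `charpolyRev N = det(1 − X • N)`. [folklore] -/
theorem eval_charpolyRev_eq_det (N : Matrix m m R) (t : R) : eval t N.charpolyRev = (1 - t • N).det := by
  rw [Matrix.charpolyRev, ← Polynomial.coe_evalRingHom, RingHom.map_det]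
  congr 1
  ext i j
  rw [RingHom.mapMatrix_apply, Matrix.map_apply, Matrix.sub_apply, Matrix.smul_apply, Matrix.map_apply, Polynomial.coe_evalRingHom, eval_sub,
    smul_eq_mul, eval_mul, eval_X, eval_C, Matrix.sub_apply, Matrix.smul_apply, smul_eq_mul]
  rcases eq_or_ne i j with rfl | hij
  · rw [Matrix.one_apply_eq, Matrix.one_apply_eq, Polynomial.eval_one]
  · rw [Matrix.one_apply_ne hij, Matrix.one_apply_ne hij, Polynomial.eval_zero]

/-- **Over a REDUCED commutative ring a unipotent matrix has determinant `1`**: `N` nilpotent ⟹ `det(1 + N) = 1`.  (`charpolyRev N` is a unit of `R[X]`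
(Mathlib `isUnit_charpolyRev_of_isNilpotent`), so its non-constant coefficients are nilpotent, hence `0`; its constant coefficient is `1`; evaluate at
`t = −1`.)  False without reducedness (`R = k[ε]/ε²`, `N = ε`). [folklore] -/
theorem det_one_add_eq_one_of_isNilpotent [IsReduced R] {N : Matrix m m R} (hN : IsNilpotent N) : (1 + N).det = 1 := by
  have hu := Matrix.isUnit_charpolyRev_of_isNilpotent hN
  obtain ⟨-, hcoef⟩ := Polynomial.isUnit_iff_coeff_isUnit_isNilpotent.1 hu
  have hC : N.charpolyRev = C (N.charpolyRev.coeff 0) := by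
    ext i
    rw [coeff_C]
    rcases eq_or_ne i 0 with rfl | hi
    · rw [if_pos rfl]
    · rw [if_neg hi]
      exact (hcoef i hi).eq_zero
  have h0 : N.charpolyRev.coeff 0 = 1 := by rw [coeff_zero_eq_eval_zero, Matrix.eval_charpolyRev]
  have h := eval_charpolyRev_eq_det N (-1)
  rw [hC, h0, map_one, eval_one, neg_smul, one_smul, sub_neg_eq_add] at h
  exact h.symm

/-! ## §3 Frame algebra: the `Δ`-block of `W_E n(X) W_E` -/

omit [DecidableEq m] in
/-- **The `(1,1)`-block of `W_E · n(X) · W_E` is `1 − 2•(X E)`** (`W_E = (1, 0; −2E, 1 − 2E)`). [cite: GelbartPiatetskishapiroRallis1987, Part A §1] -/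
theorem toBlocks₁₁_reflFrame_mul_unip_mul_reflFrame [DecidableEq m] (E X : Matrix m m R) :
    (Matrix.fromBlocks (1 : Matrix m m R) 0 (-((2 : R) • E)) (1 - (2 : R) • E) * Matrix.fromBlocks 1 X 0 1 *
        Matrix.fromBlocks 1 0 (-((2 : R) • E)) (1 - (2 : R) • E)).toBlocks₁₁ = 1 - (2 : R) • (X * E) := by
  rw [Matrix.fromBlocks_multiply, Matrix.fromBlocks_multiply, Matrix.toBlocks_fromBlocks₁₁]
  simp only [Matrix.one_mul, Matrix.mul_one, Matrix.mul_zero, add_zero, Matrix.mul_neg, Matrix.mul_smul]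
  rw [sub_eq_add_neg]

omit [DecidableEq m] in
/-- **Nilpotency under the corner condition**: `E X E = 0 ⟹ (−2•(X E))² = 0`. [cite: GelbartPiatetskishapiroRallis1987, Part A §1] -/
theorem sq_eq_zero_of_corner {E X : Matrix m m R} (hEXE : E * X * E = 0) : (-((2 : R) • (X * E))) * (-((2 : R) • (X * E))) = 0 := by
  rw [neg_mul_neg, Matrix.smul_mul, Matrix.mul_smul, show X * E * (X * E) = X * (E * X * E) by simp only [Matrix.mul_assoc], hEXE, Matrix.mul_zero,
    smul_zero, smul_zero]

/-- **`det (W_E n(X) W_E)₁₁ = 1`** under the corner condition, over a reduced ring. [cite: GelbartPiatetskishapiroRallis1987, Part A §1] -/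
theorem det_toBlocks₁₁_reflFrame_mul_unip_mul_reflFrame [IsReduced R] {E X : Matrix m m R} (hEXE : E * X * E = 0) :
    ((Matrix.fromBlocks (1 : Matrix m m R) 0 (-((2 : R) • E)) (1 - (2 : R) • E) * Matrix.fromBlocks 1 X 0 1 *
        Matrix.fromBlocks 1 0 (-((2 : R) • E)) (1 - (2 : R) • E)).toBlocks₁₁).det = 1 := by
  rw [toBlocks₁₁_reflFrame_mul_unip_mul_reflFrame, sub_eq_add_neg]
  exact det_one_add_eq_one_of_isNilpotent ⟨2, by rw [pow_two]; exact sq_eq_zero_of_corner hEXE⟩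

end Reduced

/-! ## §4 Transport to `H(𝔸)`: `det_Δ(w_g u w_g) = 1` and the inducing character -/

variable (L : Type) [Field L] [NumberField L] [IsCMField L]
variable {N M n : ℕ} (e : Fin N × Fin M ≃ Fin n)
  (dV : Fin N → L) (hdV : ∀ i, IsCMField.complexConj L (dV i) = dV i)
  (dW : Fin M → L) (hdW : ∀ i, IsCMField.complexConj L (dW i) = dW i)

/-- **The inducing character only sees `det_Δ`**: `det_Δ p = 1 ⟹ χ(det_Δ p)|det_Δ p|^{s+n/2} = 1`. [cite: Tan1999, §1] -/
theorem siegelDeltaCharacter_eq_one_of_detDelta_eq_one (χ : HeckeCharacter L) (s : ℂ) {p : HA L e dV hdV dW hdW}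
    (hd : detDelta L e dV hdV dW hdW p = 1) : siegelDeltaCharacter L e dV hdV dW hdW χ s p = 1 := by
  have hunit : IsUnit (detDelta L e dV hdV dW hdW p) := by rw [hd]; exact isUnit_one
  have h1 : hunit.unit = 1 := Units.ext (by rw [IsUnit.unit_spec, hd, Units.val_one])
  have hχ : chiDet L e dV hdV dW hdW χ p = 1 := by
    unfold chiDet
    rw [dif_pos hunit, h1, map_one]
  have hm : modDelta L e dV hdV dW hdW p = 1 := by
    unfold modDelta
    rw [dif_pos hunit, h1, ← coe_ideleNorm, map_one, NNReal.coe_one, Real.sqrt_one]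
  unfold siegelDeltaCharacter
  rw [hχ, hm]
  simp

/-- **`det_Δ(w_g · u · w_g) = 1`** for an involution `g ∈ G₁(𝔸)` and `u ∈ N_Δ(𝔸)` with the corner condition `(1 − G) X(u) (1 − G) = 0` (`G = reindex e g`):
the `Δ`-block of the conjugate is `1 − 2 X(u) E`, unipotent, over the reduced ring `𝔸_L`. [cite: GelbartPiatetskishapiroRallis1987, Part A §§1–2]
[cite: MoeglinWaldspurger1995, II.1.7] -/
theorem detDelta_reflection_conj_unip {g : UnitaryGroup.adelicPair (Fp L) L (IsCMField.complexConj L) N M (Matrix.diagonal dV) (Matrix.diagonal dW)}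
    (hg : g * g = 1) {u : HA L e dV hdV dW hdW} (hu : u ∈ unipDelta L e dV hdV dW hdW)
    (hX : (1 - Matrix.reindex e e ((g : GL (Fin N × Fin M) (AdeleRing (𝓞 L) L)) : Matrix (Fin N × Fin M) (Fin N × Fin M) (AdeleRing (𝓞 L) L))) *
          (blk L e dV hdV dW hdW u).toBlocks₁₂ *
        (1 - Matrix.reindex e e ((g : GL (Fin N × Fin M) (AdeleRing (𝓞 L) L)) : Matrix (Fin N × Fin M) (Fin N × Fin M) (AdeleRing (𝓞 L) L))) = 0) :
    detDelta L e dV hdV dW hdW (iotaGG L e dV hdV dW hdW (1, g) * u * iotaGG L e dV hdV dW hdW (1, g)) = 1 := by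
  haveI := isReduced_adeleRing L
  set G : Matrix (Fin n) (Fin n) (AdeleRing (𝓞 L) L) :=
    Matrix.reindex e e ((g : GL (Fin N × Fin M) (AdeleRing (𝓞 L) L)) : Matrix (Fin N × Fin M) (Fin N × Fin M) (AdeleRing (𝓞 L) L)) with hGdef
  set E : Matrix (Fin n) (Fin n) (AdeleRing (𝓞 L) L) := (⅟ (2 : AdeleRing (𝓞 L) L)) • (1 - G) with hEdef
  obtain ⟨hE, hG1, hG2⟩ := idem_of_involution (reindex_mul_self L e dV dW hg)
  -- the corner condition in terms of `E`
  have hEXE : E * (blk L e dV hdV dW hdW u).toBlocks₁₂ * E = 0 := by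
    rw [hEdef, Matrix.smul_mul, Matrix.smul_mul, Matrix.mul_smul, smul_smul, hX, smul_zero]
  -- the frame of the conjugate
  have hframe : Matrix.fromBlocks (1 : Matrix (Fin n) (Fin n) (AdeleRing (𝓞 L) L)) 0 (-1) 1 *
      blk L e dV hdV dW hdW (iotaGG L e dV hdV dW hdW (1, g) * u * iotaGG L e dV hdV dW hdW (1, g)) * Matrix.fromBlocks 1 0 1 1 =
        Matrix.fromBlocks (1 : Matrix (Fin n) (Fin n) (AdeleRing (𝓞 L) L)) 0 (-((2 : AdeleRing (𝓞 L) L) • E)) (1 - (2 : AdeleRing (𝓞 L) L) • E) *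
          Matrix.fromBlocks 1 (blk L e dV hdV dW hdW u).toBlocks₁₂ 0 1 *
          Matrix.fromBlocks (1 : Matrix (Fin n) (Fin n) (AdeleRing (𝓞 L) L)) 0 (-((2 : AdeleRing (𝓞 L) L) • E)) (1 - (2 : AdeleRing (𝓞 L) L) • E) := by
    rw [conj_blk_mul, conj_blk_mul, frame_iotaGG_one, ← hGdef, (mem_unipDelta_iff_conj L e dV hdV dW hdW u).1 hu, ← hG1, ← hG2]
  unfold detDelta
  rw [deltaBlock_eq_conj, hframe]
  exact det_toBlocks₁₁_reflFrame_mul_unip_mul_reflFrame hEXE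

/-- **The inducing character is trivial on the middle stabilisers**: `χ(det_Δ)|det_Δ|^{s+n/2}(w_g u w_g) = 1` under the corner condition.
[cite: MoeglinWaldspurger1995, II.1.7] [cite: KudlaRallis1994, §2] -/
theorem siegelDeltaCharacter_reflection_conj_unip (χ : HeckeCharacter L) (s : ℂ)
    {g : UnitaryGroup.adelicPair (Fp L) L (IsCMField.complexConj L) N M (Matrix.diagonal dV) (Matrix.diagonal dW)}
    (hg : g * g = 1) {u : HA L e dV hdV dW hdW} (hu : u ∈ unipDelta L e dV hdV dW hdW)
    (hX : (1 - Matrix.reindex e e ((g : GL (Fin N × Fin M) (AdeleRing (𝓞 L) L)) : Matrix (Fin N × Fin M) (Fin N × Fin M) (AdeleRing (𝓞 L) L))) *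
          (blk L e dV hdV dW hdW u).toBlocks₁₂ *
        (1 - Matrix.reindex e e ((g : GL (Fin N × Fin M) (AdeleRing (𝓞 L) L)) : Matrix (Fin N × Fin M) (Fin N × Fin M) (AdeleRing (𝓞 L) L))) = 0) :
    siegelDeltaCharacter L e dV hdV dW hdW χ s (iotaGG L e dV hdV dW hdW (1, g) * u * iotaGG L e dV hdV dW hdW (1, g)) = 1 :=
  siegelDeltaCharacter_eq_one_of_detDelta_eq_one L e dV hdV dW hdW χ s (detDelta_reflection_conj_unip L e dV hdV dW hdW hg hu hX)

/-- **THE STABILISER DATUM OF A REFLECTION ORBIT** — exactly the hypotheses `hs₀P`, `hs₀χ` of ★ file 3 `tsum_section_eq_zero` (and of ★ file 2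
`integral_wt_smul_conj_mul_apply_eq_zero`) at `γ₀ = w_g`, `s₀ = u`: for an involution `g` and `u ∈ N_Δ(𝔸)` in the corner subspace,
`w_g u w_g⁻¹ ∈ P_Δ(𝔸)` and `χ(det_Δ)|det_Δ|^{s+n/2}(w_g u w_g⁻¹) = 1` (`w_g⁻¹ = w_g`, ★ B2b). [cite: MoeglinWaldspurger1995, II.1.7] [cite: KudlaRallis1994, §2] -/
theorem reflection_stabilizer_data (χ : HeckeCharacter L) (s : ℂ)
    {g : UnitaryGroup.adelicPair (Fp L) L (IsCMField.complexConj L) N M (Matrix.diagonal dV) (Matrix.diagonal dW)}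
    (hg : g * g = 1) {u : HA L e dV hdV dW hdW} (hu : u ∈ unipDelta L e dV hdV dW hdW)
    (hX : (1 - Matrix.reindex e e ((g : GL (Fin N × Fin M) (AdeleRing (𝓞 L) L)) : Matrix (Fin N × Fin M) (Fin N × Fin M) (AdeleRing (𝓞 L) L))) *
          (blk L e dV hdV dW hdW u).toBlocks₁₂ *
        (1 - Matrix.reindex e e ((g : GL (Fin N × Fin M) (AdeleRing (𝓞 L) L)) : Matrix (Fin N × Fin M) (Fin N × Fin M) (AdeleRing (𝓞 L) L))) = 0) :
    IsSiegelDelta L e dV hdV dW hdW (iotaGG L e dV hdV dW hdW (1, g) * u * (iotaGG L e dV hdV dW hdW (1, g))⁻¹) ∧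
      siegelDeltaCharacter L e dV hdV dW hdW χ s (iotaGG L e dV hdV dW hdW (1, g) * u * (iotaGG L e dV hdV dW hdW (1, g))⁻¹) = 1 := by
  have hinv : (iotaGG L e dV hdV dW hdW (1, g))⁻¹ = iotaGG L e dV hdV dW hdW (1, g) :=
    inv_eq_of_mul_eq_one_right (iotaGG_one_mul_self L e dV hdV dW hdW hg)
  rw [hinv]
  exact ⟨(isSiegelDelta_conj_unip_iff L e dV hdV dW hdW hg hu).2 hX, siegelDeltaCharacter_reflection_conj_unip L e dV hdV dW hdW χ s hg hu hX⟩

end Summit.HodgeConjecture.HodgeConjecture.Cruxes.HLiu418.K2LiuSiegelMiddleStabilizerCharacter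

end
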